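import Summits.Ventures.PercRepro.RankLevelSetLevelEightMult4
import Summits.Ventures.PercRepro.RankLevelSetPlaneTenPrime

/-!
# PercRepro — THE CORE'S FLAT BOUNDS FROM `f(6) ≤ 39` BY THE COVER RECURSION: `f(7) ≤ 79`, `f(8) ≤ 159`, `f(9) ≤ 319`
(p4, gen 15; a feeder for S4)

The cover step `ncard_le_two_mul_add_one_of_free` (`f(k + 1) ≤ 2·f(k) + 1` on the `e`-free core) iterated from the tree's
`ncard_le_thirtynine_of_eRk_le_six_of_free` (`f(6) ≤ 39`, itself the cover step from `f(5) ≤ 19`) instead of the older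
`f(6) ≤ 43`: the bounds `87 / 175 / 351` of the level-`7 … 9` chains become `79 / 159 / 319`. Axioms: standard.
-/

open scoped Matroid

namespace PercRepro

namespace ThmN

open Set

variable {α : Type}

/-- `f(7) ≤ 79` on the `e`-free core. -/
theorem ncard_le_seventynine_of_eRk_le_seven_of_free (M : Matroid α) [M.Finite]
    (hfree : ∀ e ∈ M.E, ∃ A ⊆ M.E \ {e}, e ∉ M.closure A ∧ e ∉ M.closure ((M.E \ {e}) \ A)) :
    ∀ X ⊆ M.E, M.eRk X ≤ 7 → X.ncard ≤ 79 := by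
  intro X hX hr
  have := ncard_le_two_mul_add_one_of_free M hfree (k := 6) (B := 39)
    (fun _ hY hrY => ncard_le_thirtynine_of_eRk_le_six_of_free M hfree hY (by exact_mod_cast hrY)) X hX
    (by exact_mod_cast hr)
  omega

/-- `f(8) ≤ 159` on the `e`-free core. -/
theorem ncard_le_one_fifty_nine_of_eRk_le_eight_of_free (M : Matroid α) [M.Finite]
    (hfree : ∀ e ∈ M.E, ∃ A ⊆ M.E \ {e}, e ∉ M.closure A ∧ e ∉ M.closure ((M.E \ {e}) \ A)) :
    ∀ X ⊆ M.E, M.eRk X ≤ 8 → X.ncard ≤ 159 := by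
  intro X hX hr
  have := ncard_le_two_mul_add_one_of_free M hfree (k := 7) (B := 79)
    (fun _ hY hrY => ncard_le_seventynine_of_eRk_le_seven_of_free M hfree _ hY (by exact_mod_cast hrY)) X hX
    (by exact_mod_cast hr)
  omega

/-- `f(9) ≤ 319` on the `e`-free core. -/
theorem ncard_le_three_nineteen_of_eRk_le_nine_of_free (M : Matroid α) [M.Finite]
    (hfree : ∀ e ∈ M.E, ∃ A ⊆ M.E \ {e}, e ∉ M.closure A ∧ e ∉ M.closure ((M.E \ {e}) \ A)) :
    ∀ X ⊆ M.E, M.eRk X ≤ 9 → X.ncard ≤ 319 := by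
  intro X hX hr
  have := ncard_le_two_mul_add_one_of_free M hfree (k := 8) (B := 159)
    (fun _ hY hrY => ncard_le_one_fifty_nine_of_eRk_le_eight_of_free M hfree _ hY (by exact_mod_cast hrY)) X hX
    (by exact_mod_cast hr)
  omega

end ThmN

end PercRepro
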